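import Mathlib.Geometry.Manifold.Complex
import Literature.Geometry.Kaehler.HolomorphicChartForms
import Literature.Geometry.Kaehler.ManifoldFormsChart
import Literature.NumberTheory.Transcendental.ComplexFormsProofs
import Literature.NumberTheory.Transcendental.ComplexFormsTopType
import Literature.Geometry.Kaehler.TwoFormRealPairing
import HarnessLib

/-!
# The quotient of a closed `(2,0)`-form by a holomorphic `2`-form on a complex surface is holomorphic

Family `hodge` / trunk Kähler, layer `Literature/Geometry/Kaehler`. The surface twin of
`CurveHolomorphicOneForms` (`mdifferentiableAt_oneFormRatio`: on a curve the quotient of a closed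
`(1,0)`-form by a nowhere-vanishing holomorphic `1`-form is holomorphic; Farkas–Kra II.5.3). Let `M`
be a complex manifold charted on the complex normed space `E` with `dim_ℂ E = 2` (a complex
SURFACE), `e = (e₀, e₁)` a complex frame of `E`, `α` a smooth closed `2`-form of type `(2,0)`
(`Literature.NumberTheory.Transcendental.IsOfType 2 0`) and `ω₀` a `2`-form whose values are
`ℂ`-bilinear and which, in the chart at `x₀`, is the germ of a complex-analytic function near the
centre (the local form of `IsHolomorphicInCharts`) with `ω₀ x (e₀, e₁) ≠ 0` near `x₀`. Everything
here is PROVED (theorems only; no definitions, no named facts — D-0026):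

* `topForm_eq_ratio_smul` — pointwise `α x = (α x (b) / ω₀ x (b)) · ω₀ x` for a complex basis
  `b` (any dimension `n`): both are multiples of the complex determinant `det_b`
  (`eq_smul_cdetL_of_weight`, `eq_smul_cdetL_of_forall_update_I`: `Λ^{n,0} E^* = ℂ · dz₁ ∧ ⋯ ∧ dz_n`,
  Voisin I §2.3.1);
* `exists_restrictScalars_eq_of_basis` — a real-linear functional commuting with `i` on a complex
  basis is `ℂ`-linear;
* `mdifferentiableAt_twoFormRatio` — **the quotient `f = α(e₀,e₁)/ω₀(e₀,e₁)` is complex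
  differentiable at `x₀`**: in the chart write the representative `A = F · G` (`G` the analytic
  germ of `ω₀`); then `0 = dA(y₀) = dF ∧ G(y₀) + F dG(y₀)` and the alternatised `dG(y₀)` is a
  `ℂ`-trilinear alternating form on the `2`-dimensional `E` (zero "for reasons of type", Voisin I,
  proof of Cor. 7.6), while `(dF ∧ G)(i e_k, e₀, e₁) = (∂_{i e_k} F − i ∂_{e_k} F) · (± G(e₀, e₁))`,
  so `dF` commutes with `i` on the frame: `F` is holomorphic at `y₀` (Voisin I, §2.3.3: a
  `d`-closed `(p,0)`-form is holomorphic; Huybrechts Prop. 2.6.11).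

In print: "the quotient of two holomorphic sections of the canonical bundle is a meromorphic
function" (Farkas–Kra II.5.2–II.5.3 for curves; Griffiths–Harris, Ch. 1 §1, divisors and line
bundles), combined with the type computation `dα = ∂̄α` for `α ∈ A^{n,0}`. Consumer: the
holomorphic `2`-forms of the Fermat surface read against Griffiths' residue forms
(`AlgebraicGeometry/HodgeTheory/FermatSurfaceEigenformsOnModels`).

## References

* [FarkasKra1992] H. M. Farkas, I. Kra, Riemann Surfaces, 2nd ed., GTM 71 (1992), II.5.2–II.5.3.
* [VoisinHodgeI2002] C. Voisin, Hodge Theory and Complex Algebraic Geometry I (2002), §2.3.1,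
  §2.3.3, Cor. 7.6 (proof).
* [Huybrechts2005] D. Huybrechts, Complex Geometry (2005), Prop. 2.6.11.
-/

noncomputable section

open scoped Manifold ContDiff Topology
open Set Filter Complex Function
open Literature.NumberTheory.Transcendental

namespace Literature.Geometry.Kaehler

variable {E : Type*} [NormedAddCommGroup E] [NormedSpace ℂ E]

/-! ### Linear algebra: `ℂ`-multilinear alternating forms read as real ones -/

section Plane

/-- A `ℂ`-alternating form, read as a real one, is `ℂ`-homogeneous for `i` in every slot.
[folklore] -/
theorem restrictScalars_apply_update_I_smul {n : ℕ} (a : E [⋀^Fin n]→L[ℂ] ℂ) (v : Fin n → E)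
    (j : Fin n) : (a.restrictScalars ℝ) (update v j (I • v j)) = I * (a.restrictScalars ℝ) v := by
  rw [ContinuousAlternatingMap.coe_restrictScalars, a.map_update_smul, update_eq_self, smul_eq_mul]

/-- A `ℂ`-alternating `n`-form on an `n`-dimensional space is `a(b) · det_b` for every complex
basis `b`. [cite: VoisinHodgeI2002, §2.3.1] -/
theorem restrictScalars_eq_smul_cdetL [FiniteDimensional ℂ E] {n : ℕ} (a : E [⋀^Fin n]→L[ℂ] ℂ)
    (b : Module.Basis (Fin n) ℂ E) : a.restrictScalars ℝ = a b • cdetL b := by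
  have h := eq_smul_cdetL_of_forall_update_I (a.restrictScalars ℝ)
    (fun v j ↦ restrictScalars_apply_update_I_smul a v j) b
  rw [h, ContinuousAlternatingMap.coe_restrictScalars]

/-- **Two multiples of the complex determinant are proportional**: if `φ = φ(b) det_b`,
`ψ = ψ(b) det_b` and `ψ(b) ≠ 0` then `φ = (φ(b)/ψ(b)) · ψ`. [folklore] -/
theorem eq_ratio_smul_of_eq_smul_cdetL [FiniteDimensional ℂ E] {n : ℕ} {φ ψ : E [⋀^Fin n]→L[ℝ] ℂ}
    {b : Module.Basis (Fin n) ℂ E} (hφ : φ = φ b • cdetL b) (hψ : ψ = ψ b • cdetL b)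
    (hne : ψ b ≠ 0) : φ = (φ b / ψ b) • ψ :=
  calc φ = φ b • cdetL b := hφ
    _ = ((φ b / ψ b) * ψ b) • cdetL b := by rw [div_mul_cancel₀ _ hne]
    _ = (φ b / ψ b) • (ψ b • cdetL b) := by rw [smul_smul]
    _ = (φ b / ψ b) • ψ := by rw [← hψ]

/-- **A real-linear functional commuting with `i` on a complex basis is `ℂ`-linear**: if
`L(i b_k) = i L(b_k)` for all `k`, then `L` is the restriction of scalars of a `ℂ`-linear
functional. [folklore] -/
theorem exists_restrictScalars_eq_of_basis {ι : Type*} [Fintype ι] (b : Module.Basis ι ℂ E)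
    (L : E →L[ℝ] ℂ) (hL : ∀ k, L (I • b k) = I * L (b k)) :
    ∃ L' : E →L[ℂ] ℂ, L'.restrictScalars ℝ = L := by
  -- `L (z • b k) = z * L (b k)` for every complex `z`
  have hz : ∀ (z : ℂ) (k : ι), L (z • b k) = z * L (b k) := by
    intro z k
    conv_lhs => rw [← Complex.re_add_im z]
    rw [add_smul, map_add, mul_smul, Complex.coe_smul, Complex.coe_smul, L.map_smul, L.map_smul, hL]
    conv_rhs => rw [← Complex.re_add_im z]
    simp only [Complex.real_smul]
    ring
  have hsm : ∀ (c : ℂ) (v : E), L (c • v) = c * L v := by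
    intro c v
    conv_lhs => rw [← b.sum_repr v, Finset.smul_sum, map_sum]
    conv_rhs => rw [← b.sum_repr v, map_sum, Finset.mul_sum]
    refine Finset.sum_congr rfl fun k _ ↦ ?_
    rw [smul_smul, hz, hz, mul_assoc]
  refine ⟨⟨⟨⟨L, L.map_add⟩, fun c v ↦ by simpa using hsm c v⟩, L.continuous⟩, ?_⟩
  ext v
  rfl

/-- A `ℂ`-bilinear alternating form kills `(i v, v)`. [folklore] -/
theorem apply_pair_I_smul_self_complex (a : E [⋀^Fin 2]→L[ℂ] ℂ) (v : E) : a ![I • v, v] = 0 := by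
  rw [apply_pair_I_smul_left, apply_pair_self_complex, mul_zero]

end Plane

/-! ### Pointwise: a `(n,0)`-form is a function multiple of a non-vanishing `ℂ`-multilinear `n`-form -/

section Pointwise

variable [FiniteDimensional ℂ E] {M : Type*} [TopologicalSpace M] [ChartedSpace E M] {n : ℕ}

/-- At every point an `n`-form of type `(n,0)` is `η(b) · det_b` for every complex basis `b`
(`eq_smul_cdetL_of_weight`; `Λ^{n,0} E^* = ℂ · dz₁ ∧ ⋯ ∧ dz_n`). [cite: VoisinHodgeI2002, §2.3.1] -/
theorem _root_.Literature.NumberTheory.Transcendental.IsOfType.eq_apply_smul_cdetL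
    {η : MForm 𝓘(ℝ, E) M ℂ n} (hη : IsOfType n 0 η) (b : Module.Basis (Fin n) ℂ E) (x : M) :
    (η x : E [⋀^Fin n]→L[ℝ] ℂ) = (η x b) • cdetL b := by
  refine eq_smul_cdetL_of_weight _ (fun θ v ↦ ?_) b
  have h := hη.2 x θ v
  simp only [tangentRotate_apply, Nat.cast_zero, sub_zero, Int.cast_natCast] at h
  exact h

/-- **`α = f · ω₀` pointwise** for `α` of type `(n,0)` and `ω₀` with `ℂ`-multilinear value at `x`
non-zero on the complex basis `b` (`dim_ℂ E = n`), with `f x = α x (b) / ω₀ x (b)`.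
[cite: FarkasKra1992, II.5.2] [cite: VoisinHodgeI2002, §2.3.1] -/
theorem topForm_eq_ratio_smul {α ω₀ : MForm 𝓘(ℝ, E) M ℂ n} (hα : IsOfType n 0 α)
    (b : Module.Basis (Fin n) ℂ E) {x : M} {a : E [⋀^Fin n]→L[ℂ] ℂ}
    (hω : (ω₀ x : E [⋀^Fin n]→L[ℝ] ℂ) = a.restrictScalars ℝ)
    (hne : (ω₀ x : E [⋀^Fin n]→L[ℝ] ℂ) b ≠ 0) :
    (α x : E [⋀^Fin n]→L[ℝ] ℂ) =
      ((α x : E [⋀^Fin n]→L[ℝ] ℂ) b / (ω₀ x : E [⋀^Fin n]→L[ℝ] ℂ) b) • (ω₀ x : E [⋀^Fin n]→L[ℝ] ℂ) := by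
  refine eq_ratio_smul_of_eq_smul_cdetL (E := E) (hα.eq_apply_smul_cdetL b x) ?_ hne
  have h := restrictScalars_eq_smul_cdetL a b
  have hab : (a.restrictScalars ℝ) b = a b := rfl
  rw [← hab, ← hω] at h
  exact h

end Pointwise

/-! ### Holomorphy of the quotient on a complex surface -/

section Chart

variable [FiniteDimensional ℂ E] {M : Type*} [TopologicalSpace M] [ChartedSpace E M]
  [IsManifold 𝓘(ℝ, E) ∞ M]

/-- **The quotient of a closed `(2,0)`-form by a holomorphic `2`-form is holomorphic (complex
surfaces).** On a complex manifold `M` charted on `E` with `dim_ℂ E = 2`, let `e = (e₀, e₁)` be a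
complex frame of `E`, `α` a smooth closed `2`-form of type `(2,0)`, and `ω₀` a `2`-form with
`ℂ`-bilinear values, whose representative in the chart at `x₀` is the germ of a complex-analytic
function at the centre, and with `ω₀ x (e₀, e₁) ≠ 0` for `x` near `x₀`. Then
`f = α(e₀,e₁)/ω₀(e₀,e₁)` (so that `α = f · ω₀` near `x₀`, `topForm_eq_ratio_smul`) is complex
differentiable at `x₀`. In the chart at `x₀` write `A = F · G`, `G` the analytic germ of `ω₀`; then
`0 = dA(y₀)(i e_k, e₀, e₁) = (∂_{i e_k}F − i ∂_{e_k}F) · (± G(e₀,e₁))` (the alternatised `dG(y₀)`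
is a `ℂ`-trilinear alternating form on the plane `E`, hence `0`), so `dF(y₀)` commutes with `i` on
the frame and `F` is holomorphic at `y₀`.
[cite: FarkasKra1992, II.5.3 (proof of the Corollary)] [cite: VoisinHodgeI2002, §2.3.3 and Cor. 7.6 (proof)]
[cite: Huybrechts2005, Prop. 2.6.11] -/
theorem mdifferentiableAt_twoFormRatio (h2 : Module.finrank ℂ E = 2) {α ω₀ : MForm 𝓘(ℝ, E) M ℂ 2}
    (hαs : IsSmoothForm α) (hαc : IsClosedForm α) (hα : IsOfType 2 0 α) {e : Fin 2 → E}
    (he : LinearIndependent ℂ e) {x₀ : M}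
    (hωC : ∀ x, ∃ a : E [⋀^Fin 2]→L[ℂ] ℂ, (ω₀ x : E [⋀^Fin 2]→L[ℝ] ℂ) = a.restrictScalars ℝ)
    (hω : ∃ g : E → E [⋀^Fin 2]→L[ℂ] ℂ, AnalyticAt ℂ g (extChartAt 𝓘(ℝ, E) x₀ x₀) ∧
      ω₀.inChart x₀ =ᶠ[𝓝 (extChartAt 𝓘(ℝ, E) x₀ x₀)] fun y ↦ (g y).restrictScalars ℝ)
    (hne : ∀ᶠ x in 𝓝 x₀, (ω₀ x : E [⋀^Fin 2]→L[ℝ] ℂ) e ≠ 0) :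
    MDifferentiableAt 𝓘(ℂ, E) 𝓘(ℂ, ℂ)
      (fun x ↦ (α x : E [⋀^Fin 2]→L[ℝ] ℂ) e / (ω₀ x : E [⋀^Fin 2]→L[ℝ] ℂ) e) x₀ := by
  -- the frame as a basis
  have hcard : Fintype.card (Fin 2) = Module.finrank ℂ E := by simp [h2]
  set b : Module.Basis (Fin 2) ℂ E := basisOfLinearIndependentOfCardEqFinrank he hcard with hbdef
  have hb : (b : Fin 2 → E) = e := coe_basisOfLinearIndependentOfCardEqFinrank he hcard
  have he01 : e = ![e 0, e 1] := by funext i; fin_cases i <;> rfl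
  set f : M → ℂ := fun x ↦ (α x : E [⋀^Fin 2]→L[ℝ] ℂ) e / (ω₀ x : E [⋀^Fin 2]→L[ℝ] ℂ) e with hfdef
  set φ := extChartAt 𝓘(ℝ, E) x₀ with hφ
  set y₀ : E := φ x₀ with hy₀
  set A : E → E [⋀^Fin 2]→L[ℝ] ℂ := α.inChart x₀ with hA
  set G : E → E [⋀^Fin 2]→L[ℝ] ℂ := ω₀.inChart x₀ with hG
  set F : E → ℂ := f ∘ φ.symm with hF
  have hy₀t : y₀ ∈ φ.target := mem_extChartAt_target x₀
  have hsymm : φ.symm y₀ = x₀ := extChartAt_to_inv x₀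
  have hsymmc : ContinuousAt φ.symm y₀ := continuousAt_extChartAt_symm x₀
  -- (1) `A = F • G` near `y₀` (the chart representative is linear over the functions)
  have hne' : ∀ᶠ y in 𝓝 y₀, (ω₀ (φ.symm y) : E [⋀^Fin 2]→L[ℝ] ℂ) e ≠ 0 := by
    have h : ∀ᶠ x in 𝓝 (φ.symm y₀), (ω₀ x : E [⋀^Fin 2]→L[ℝ] ℂ) e ≠ 0 := by rw [hsymm]; exact hne
    exact hsymmc.tendsto.eventually h
  have hAFG : ∀ᶠ y in 𝓝 y₀, A y = F y • G y := by
    filter_upwards [hne'] with y hy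
    obtain ⟨a, ha⟩ := hωC (φ.symm y)
    have hyb : (ω₀ (φ.symm y) : E [⋀^Fin 2]→L[ℝ] ℂ) b ≠ 0 := by rw [hb]; exact hy
    have key := topForm_eq_ratio_smul hα b ha hyb
    rw [hb] at key
    simp only [hA, hG, hF, MForm.inChart, Function.comp_apply]
    rw [key]
    ext v
    rfl
  -- (2) the holomorphic germ `g` of `G` at the centre, and the scalar germ `γ = g(e)`
  obtain ⟨g, hg, hGg⟩ := hω
  change AnalyticAt ℂ g y₀ at hg
  change G =ᶠ[𝓝 y₀] fun y ↦ (g y).restrictScalars ℝ at hGg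
  set γ : E → ℂ := fun y ↦ g y e with hγ
  have hγan : AnalyticAt ℂ γ y₀ := ((ContinuousAlternatingMap.apply ℂ E ℂ e).analyticAt _).comp hg
  have hGy₀ : G y₀ = (g y₀).restrictScalars ℝ := hGg.self_of_nhds
  have hγ0 : γ y₀ ≠ 0 := by
    have h1 : (G y₀ : E [⋀^Fin 2]→L[ℝ] ℂ) e = γ y₀ := by rw [hGy₀]; rfl
    have h2' : G y₀ = ω₀ x₀ := MForm.inChart_apply_self ω₀ x₀
    intro h0
    apply hne.self_of_nhds
    have h3 : (G y₀ : E [⋀^Fin 2]→L[ℝ] ℂ) e = 0 := h1.trans h0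
    rw [h2'] at h3
    exact h3
  -- (3) `A` is `C^∞` at every point of the chart target (smoothness of `α` transported)
  have hAsm : ∀ y ∈ φ.target, ContDiffAt ℝ ∞ A y := by
    intro y hy
    have hz : φ.symm y ∈ φ.source := φ.map_target hy
    have h := MForm.SmoothAt.contDiffWithinAt_inChart (α := α) (x₀ := x₀) hz (hαs (φ.symm y))
    rw [φ.right_inv hy, ModelWithCorners.Boundaryless.range_eq_univ] at h
    exact h.contDiffAt univ_mem
  have hAd : DifferentiableAt ℝ A y₀ := (hAsm y₀ hy₀t).differentiableAt (by simp)
  -- (4) closedness read in the chart: `extDeriv A y₀ = 0`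
  have hdA : extDeriv A y₀ = 0 := by
    have h := inChart_mextDeriv_of_mem_target α hy₀t (by rw [hsymm]; exact hαs x₀)
    have h0 : mextDeriv α = 0 := hαc
    rw [h0, MForm.inChart_zero, ModelWithCorners.Boundaryless.range_eq_univ,
      extDerivWithin_univ] at h
    exact h.symm
  -- the slots as functions of `y` near `y₀`: `A y w = F y * g y w`
  have hslot : ∀ w : Fin 2 → E, (fun y ↦ A y w) =ᶠ[𝓝 y₀] fun y ↦ F y * g y w := by
    intro w
    filter_upwards [hGg, hAFG] with y hy hyA
    simp only [hyA, hy, ContinuousAlternatingMap.smul_apply, smul_eq_mul,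
      ContinuousAlternatingMap.coe_restrictScalars]
  have hgw : ∀ w : Fin 2 → E, DifferentiableAt ℝ (fun y ↦ g y w) y₀ := fun w ↦
    (((ContinuousAlternatingMap.apply ℂ E ℂ w).analyticAt _).comp hg).differentiableAt.restrictScalars ℝ
  -- `F` is real differentiable at `y₀`: `F = (A · e) · γ⁻¹` near `y₀`
  have ha₀d : DifferentiableAt ℝ (fun y ↦ A y e) y₀ :=
    ((ContinuousAlternatingMap.apply ℝ E ℂ e).differentiableAt).comp y₀ hAd
  have hγne : ∀ᶠ y in 𝓝 y₀, γ y ≠ 0 := hγan.continuousAt.eventually_ne hγ0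
  have hFeq : F =ᶠ[𝓝 y₀] fun y ↦ A y e * (γ y)⁻¹ := by
    filter_upwards [hslot e, hγne] with y hy hyne
    rw [hy, mul_inv_cancel_right₀ hyne]
  have hγinv : AnalyticAt ℂ (fun y ↦ (γ y)⁻¹) y₀ := hγan.inv hγ0
  have hFd : DifferentiableAt ℝ F y₀ :=
    (ha₀d.mul (hγinv.differentiableAt.restrictScalars ℝ)).congr_of_eventuallyEq hFeq
  -- derivative of a slot: `D(A · w)(y₀) h = DF(h) g y₀ w + F y₀ (Dg h) w`
  have hDg : ∀ (w : Fin 2 → E) (h : E), fderiv ℝ (fun y ↦ g y w) y₀ h = (fderiv ℂ g y₀ h) w := by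
    intro w h
    have h1 : HasFDerivAt (fun y ↦ g y w)
        (((ContinuousAlternatingMap.apply ℂ E ℂ w).restrictScalars ℝ).comp
          ((fderiv ℂ g y₀).restrictScalars ℝ)) y₀ :=
      ((ContinuousAlternatingMap.apply ℂ E ℂ w).hasFDerivAt.restrictScalars ℝ).comp y₀
        (hg.differentiableAt.hasFDerivAt.restrictScalars ℝ)
    rw [h1.fderiv]
    rfl
  have hDslot : ∀ (w : Fin 2 → E) (h : E), fderiv ℝ (fun y ↦ A y w) y₀ h =
      fderiv ℝ F y₀ h * g y₀ w + F y₀ * (fderiv ℂ g y₀ h) w := by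
    intro w h
    rw [(hslot w).fderiv_eq, fderiv_fun_mul hFd (hgw w), ← hDg]
    change F y₀ * fderiv ℝ (fun y ↦ g y w) y₀ h + g y₀ w * fderiv ℝ F y₀ h = _
    ring
  -- the alternatised `Dg(y₀)` vanishes on three vectors of the plane
  have hr : ∀ (u : E) (k : Fin 3), (k.removeNth ![u, e 0, e 1]) =
      ![![e 0, e 1], ![u, e 1], ![u, e 0]] k := by
    intro u k
    fin_cases k <;> (funext j; fin_cases j <;> rfl)
  have halt : ∀ u : E, (fderiv ℂ g y₀ (I • u)) ![e 0, e 1] - (fderiv ℂ g y₀ (e 0)) ![I • u, e 1] +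
      (fderiv ℂ g y₀ (e 1)) ![I • u, e 0] = 0 := by
    intro u
    have h := continuousAlternatingMap_apply_eq_zero_of_finrank_lt
      (ContinuousAlternatingMap.alternatizeUncurryFin (fderiv ℂ g y₀)) (by omega) ![I • u, e 0, e 1]
    rw [ContinuousAlternatingMap.alternatizeUncurryFin_apply] at h
    simp only [Fin.sum_univ_succ, Fin.sum_univ_zero, hr] at h
    simp only [Fin.isValue, Matrix.cons_val_zero, Fin.val_zero, pow_zero, one_smul,
      Fin.succ_zero_eq_one, Matrix.cons_val_one, Fin.val_one, pow_one, neg_smul,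
      Fin.succ_one_eq_two, Matrix.cons_val, Fin.val_two, neg_one_sq, add_zero] at h
    linear_combination h
  -- (5) closedness on the vectors `(i u, e₀, e₁)`:
  -- `DF(i u) g(e₀,e₁) − DF(e₀) g(i u, e₁) + DF(e₁) g(i u, e₀) = 0`
  have hclosed : ∀ u : E, fderiv ℝ F y₀ (I • u) * g y₀ ![e 0, e 1] -
      fderiv ℝ F y₀ (e 0) * g y₀ ![I • u, e 1] + fderiv ℝ F y₀ (e 1) * g y₀ ![I • u, e 0] = 0 := by
    intro u
    have h := extDeriv_apply hAd ![I • u, e 0, e 1]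
    rw [hdA] at h
    simp only [ContinuousAlternatingMap.coe_zero, Pi.zero_apply, Fin.sum_univ_succ,
      Fin.sum_univ_zero, hr] at h
    simp only [Fin.isValue, Matrix.cons_val_zero, Fin.val_zero, pow_zero, one_smul,
      Fin.succ_zero_eq_one, Matrix.cons_val_one, Fin.val_one, pow_one, neg_smul,
      Fin.succ_one_eq_two, Matrix.cons_val, Fin.val_two, neg_one_sq, add_zero, hDslot] at h
    linear_combination -h - F y₀ * halt u
  -- (6) `∂_{i e_k} F = i ∂_{e_k} F`
  have hγe : g y₀ ![e 0, e 1] = γ y₀ := by rw [hγ, ← he01]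
  have hk0 : fderiv ℝ F y₀ (I • e 0) = I * fderiv ℝ F y₀ (e 0) := by
    have h := hclosed (e 0)
    rw [apply_pair_I_smul_self_complex, apply_pair_I_smul_left, hγe, mul_zero,
      add_zero] at h
    have h' : (fderiv ℝ F y₀ (I • e 0) - I * fderiv ℝ F y₀ (e 0)) * γ y₀ = 0 := by
      linear_combination h
    exact sub_eq_zero.1 ((mul_eq_zero.1 h').resolve_right hγ0)
  have hk1 : fderiv ℝ F y₀ (I • e 1) = I * fderiv ℝ F y₀ (e 1) := by
    have h := hclosed (e 1)
    rw [apply_pair_I_smul_self_complex, apply_pair_I_smul_left, hγe,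
      apply_pair_swap_complex, hγe, mul_zero, sub_zero] at h
    have h' : (fderiv ℝ F y₀ (I • e 1) - I * fderiv ℝ F y₀ (e 1)) * γ y₀ = 0 := by
      linear_combination h
    exact sub_eq_zero.1 ((mul_eq_zero.1 h').resolve_right hγ0)
  have hkey : ∀ k : Fin 2, fderiv ℝ F y₀ (I • b k) = I * fderiv ℝ F y₀ (b k) := by
    rw [hb]
    intro k
    fin_cases k
    exacts [hk0, hk1]
  obtain ⟨L', hL'⟩ := exists_restrictScalars_eq_of_basis b (fderiv ℝ F y₀) hkey
  have hFdC : DifferentiableAt ℂ F y₀ := (differentiableAt_iff_restrictScalars ℝ hFd).2 ⟨L', hL'⟩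
  -- (7) conclusion
  rw [mdifferentiableAt_iff]
  refine ⟨?_, ?_⟩
  · have hev : (F ∘ φ) =ᶠ[𝓝 x₀] f := by
      filter_upwards [extChartAt_source_mem_nhds (I := 𝓘(ℝ, E)) x₀] with x hx
      simp only [hF, Function.comp_apply, φ.left_inv hx]
    exact (hFdC.continuousAt.comp (continuousAt_extChartAt (I := 𝓘(ℝ, E)) x₀)).congr hev
  · simp only [writtenInExtChartAt, extChartAt_model_space_eq_id, PartialEquiv.refl_coe,
      CompTriple.comp_eq]
    exact hFdC.differentiableWithinAt

end Chart

end Literature.Geometry.Kaehler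

end
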